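import Summits.QuantumFields.YangMills.Theorems.FluctuationComparisonRegPrIntLOneBondInverse
import HarnessLib

/-!
# `FluctuationComparisonRegPrIntLOneBondLocalInverse` — THE ONE-BOND LOCAL INVERSE AS A MAP OF (ENVIRONMENT, TARGET): existence packaged, jointly Lipschitz,
# jointly continuous on the good set (the `θ ∕ hright ∕ hleft ∕ hmaps ∕ hθc` letters of the triangular chart at `descend`, per bond)

Cell `ym3-torus` (rung R3 = continuum `SU(2)` Yang–Mills on the three-torus — NOT d = 4, NOT infinite volume, NOT a mass gap, NOT Clay), width seat
`ym-ust-20520-w5` (gen 21), pen (B1′) «Stage 1, part 4» (LEAD-20520 w3 g22 18:23:30Z: «∃-corollary, GLOBAL in the environment, joint continuity (+ measurability if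
cheap)»).  `--kind proof --supports stmt-QuantumFields-20520 --as helper`, count-neutral, definition-free, default heartbeats; THEOREMS ONLY; nothing printed is asserted.
Inputs BY NAME: ✓`…OneBondInverse` ★`oneBond_injOn`, ★★`oneBond_exists_preimage`, ★★★`oneBond_preimage_lipschitz`.

* §1 `oneBond_localInverse` — ONE environment `V` with centre `V̄`: `∃ θ : SU(N) → SU(N)` right inverse on the target ball `‖v − V̄‖ ≤ ρ′`
  (`ρ′ := ρ − ((m∕|ι|)r + 36r²)`, `r := s + ρ`), values in the closed `ρ`-ball, left inverse there, `(1 − q)⁻¹`-Lipschitz.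
* §2 ★★ `oneBond_localInverse_family` — ALL environments at once, centre `V i₀` (a fixed index `i₀`): `∃ θ : (ι → SU(N)) → SU(N) → SU(N)` such that for every
  GOOD environment (`∀ ¬p i, ‖V i − V i₀‖ ≤ s`) and every target in its ball: ball membership + right inverse; left inverse (uniqueness) in the `ρ`-ball; and the JOINT
  estimate `(1 − q₊)·‖θ V v − θ V′ v′‖ ≤ ‖v − v′‖ + 12·max_{¬p i}‖V i − V′ i‖` for two good environments at distance `≤ d₀` (`q₊ := m∕|ι| + 144 (s + ρ + d₀)`), whence
  ★★★ `continuousOn_oneBond_localInverse_family`: `(V, v) ↦ θ V v` is CONTINUOUS ON the good set `{(V, v) : V good, ‖v − V i₀‖ ≤ ρ′}` (product∕sup distance).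
  `θ` is `Classical.choose` of ★★ on the good set and `1` off it — a `Theorems/` proof may choose; measurability is left to the consumer (continuous on a closed set,
  constant off it).

HOW (L5) READS IT: per coarse bond `c`, `V := openHol U c` (environment), `p := IsCentral c`, `i₀` any index, target `v` = the coarse bond value, argument `W = pre·g·post`
(✓`BlockAveragingEMLHaarAC.fibreFamily` ∕ `avgFun_update_centralBond_self`); `T c U :=` an open sub-ball of the target ball (inner `T′` = half radius), `Ω c U :=` its
`θ`-image inside the `ρ`-ball; GOOD = spread `≤ s`; the geometry letters (small fields are good and sit inside the inner balls) are ✓-to-be `…OneBondGeometry`.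
NOT HERE: the inverse LAW (Stage 2), the spread lift; nothing of `descend`∕VER∘∕(A)∕COAREA∘∕O1∕20520∕`YM3TorusSU2` is proved.  No `def`, `instance`, `notation`, `sorry`.
-/

noncomputable section

open Set Metric NormedSpace Function

namespace Summit.QuantumFields.YangMills.Theorems.FluctuationComparisonRegPrIntLOneBondLocalInverse

open Literature.MathematicalPhysics.QuantumFieldTheory.Balaban1983to89
open ExpMeanLog (eml deltaSU expMeanLogSU)
open Summit.QuantumFields.YangMills.Theorems.FluctuationComparisonRegPrIntLOneBondInverse

open scoped Matrix.Norms.L2Operator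

variable {n : Type*} [Fintype n] [DecidableEq n] [Nonempty n] {ι : Type*} [Fintype ι] [Nonempty ι]

/-- §1 ★ **THE LOCAL INVERSE, PACKAGED, ONE ENVIRONMENT** (the `θ ∕ hright ∕ hleft ∕ hmaps ∕ hθc` letters of the triangular chart for ONE bond and ONE environment, discharged):
under the hypotheses of ★★ there is a map `θ : SU(N) → SU(N)` which, on the target ball `‖v − V̄‖ ≤ ρ′` (`ρ′ := ρ − ((m∕|ι|)r + 36r²)`), takes values in the
closed `ρ`-ball, is a RIGHT inverse of `F_V` there, a LEFT inverse of `F_V` on `{W : ‖W − V̄‖ ≤ ρ, ‖F_V W − V̄‖ ≤ ρ′}`, and is `(1 − q)⁻¹`-LIPSCHITZ (hence continuous)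
on the target ball. [cite: Balaban1987RG1, (0.4) p.253 and (2.4) p.266] -/
theorem oneBond_localInverse (p : ι → Prop) [DecidablePred p] (V : ι → Matrix.specialUnitaryGroup n ℂ)
    (Vbar : Matrix.specialUnitaryGroup n ℂ) {s ρ : ℝ} (hs0 : 0 ≤ s) (hρ0 : 0 ≤ ρ)
    (hs : ∀ i, ¬ p i → ‖(V i : Matrix n n ℂ) - (Vbar : Matrix n n ℂ)‖ ≤ s)
    (hr : s + ρ ≤ 1 / 24) (hrδ : s + ρ < deltaSU n)
    (hq : ((Finset.univ.filter fun i => ¬ p i).card : ℝ) / (Fintype.card ι : ℝ) + 144 * (s + ρ) < 1) :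
    ∃ θ : Matrix.specialUnitaryGroup n ℂ → Matrix.specialUnitaryGroup n ℂ,
      (∀ v : Matrix.specialUnitaryGroup n ℂ, ‖(v : Matrix n n ℂ) - (Vbar : Matrix n n ℂ)‖ ≤
          ρ - (((Finset.univ.filter fun i => ¬ p i).card : ℝ) / (Fintype.card ι : ℝ) * (s + ρ) + 36 * (s + ρ) ^ 2) →
        ‖(θ v : Matrix n n ℂ) - (Vbar : Matrix n n ℂ)‖ ≤ ρ ∧
          (expMeanLogSU (n := n)).avg (fun i => if p i then (1 : Matrix.specialUnitaryGroup n ℂ) else V i * (θ v)⁻¹) * θ v = v) ∧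
      (∀ W : Matrix.specialUnitaryGroup n ℂ, ‖(W : Matrix n n ℂ) - (Vbar : Matrix n n ℂ)‖ ≤ ρ →
        ‖(((expMeanLogSU (n := n)).avg (fun i => if p i then (1 : Matrix.specialUnitaryGroup n ℂ) else V i * W⁻¹) * W :
            Matrix.specialUnitaryGroup n ℂ) : Matrix n n ℂ) - (Vbar : Matrix n n ℂ)‖ ≤
          ρ - (((Finset.univ.filter fun i => ¬ p i).card : ℝ) / (Fintype.card ι : ℝ) * (s + ρ) + 36 * (s + ρ) ^ 2) →
        θ ((expMeanLogSU (n := n)).avg (fun i => if p i then (1 : Matrix.specialUnitaryGroup n ℂ) else V i * W⁻¹) * W) = W) ∧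
      (∀ v v' : Matrix.specialUnitaryGroup n ℂ,
        ‖(v : Matrix n n ℂ) - (Vbar : Matrix n n ℂ)‖ ≤
          ρ - (((Finset.univ.filter fun i => ¬ p i).card : ℝ) / (Fintype.card ι : ℝ) * (s + ρ) + 36 * (s + ρ) ^ 2) →
        ‖(v' : Matrix n n ℂ) - (Vbar : Matrix n n ℂ)‖ ≤
          ρ - (((Finset.univ.filter fun i => ¬ p i).card : ℝ) / (Fintype.card ι : ℝ) * (s + ρ) + 36 * (s + ρ) ^ 2) →
        (1 - (((Finset.univ.filter fun i => ¬ p i).card : ℝ) / (Fintype.card ι : ℝ) + 144 * (s + ρ))) *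
            ‖(θ v : Matrix n n ℂ) - (θ v' : Matrix n n ℂ)‖ ≤ ‖(v : Matrix n n ℂ) - (v' : Matrix n n ℂ)‖) := by
  classical
  set ρ' : ℝ := ρ - (((Finset.univ.filter fun i => ¬ p i).card : ℝ) / (Fintype.card ι : ℝ) * (s + ρ) + 36 * (s + ρ) ^ 2) with hρ'
  -- the family ball of radius `r = s + ρ` contains the `ρ`-ball about the centre
  have hfam : ∀ W : Matrix.specialUnitaryGroup n ℂ, ‖(W : Matrix n n ℂ) - (Vbar : Matrix n n ℂ)‖ ≤ ρ →
      ∀ i, ¬ p i → ‖(V i : Matrix n n ℂ) - (W : Matrix n n ℂ)‖ ≤ s + ρ := by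
    intro W hW i hi
    calc ‖(V i : Matrix n n ℂ) - (W : Matrix n n ℂ)‖
        = ‖((V i : Matrix n n ℂ) - (Vbar : Matrix n n ℂ)) + ((Vbar : Matrix n n ℂ) - (W : Matrix n n ℂ))‖ := by rw [sub_add_sub_cancel]
      _ ≤ s + ρ := (norm_add_le _ _).trans (add_le_add (hs i hi) (by rw [norm_sub_rev]; exact hW))
  have hex : ∀ v : Matrix.specialUnitaryGroup n ℂ, ‖(v : Matrix n n ℂ) - (Vbar : Matrix n n ℂ)‖ ≤ ρ' →
      ∃ W : Matrix.specialUnitaryGroup n ℂ, ‖(W : Matrix n n ℂ) - (Vbar : Matrix n n ℂ)‖ ≤ ρ ∧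
        (expMeanLogSU (n := n)).avg (fun i => if p i then (1 : Matrix.specialUnitaryGroup n ℂ) else V i * W⁻¹) * W = v :=
    fun v hv => oneBond_exists_preimage p V Vbar hs0 hρ0 hs hr hrδ hq v hv
  -- the inverse: the Banach preimage on the target ball, `1` elsewhere
  refine ⟨fun v => if hv : ‖(v : Matrix n n ℂ) - (Vbar : Matrix n n ℂ)‖ ≤ ρ' then Classical.choose (hex v hv) else 1, ?_, ?_, ?_⟩
  · intro v hv
    simp only [dif_pos hv]
    exact Classical.choose_spec (hex v hv)
  · intro W hW hFW
    simp only [dif_pos hFW]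
    have hspec := Classical.choose_spec (hex _ hFW)
    exact oneBond_injOn p V (by positivity) hr hrδ hq (hfam _ hspec.1) (hfam _ hW) hspec.2
  · intro v v' hv hv'
    simp only [dif_pos hv, dif_pos hv']
    have h1 := Classical.choose_spec (hex v hv)
    have h2 := Classical.choose_spec (hex v' hv')
    have h := oneBond_preimage_lipschitz p V V (d := 0) (by positivity) hr hrδ le_rfl (by norm_num)
      (fun i _ => by rw [sub_self, norm_zero]) (hfam _ h1.1) (hfam _ h2.1) (hfam _ h2.1) h1.2 h2.2
    linarith

/-- §2 ★★ **THE LOCAL INVERSE AS A MAP OF (ENVIRONMENT, TARGET)**, centre `V i₀`: existence∕ball membership∕right inverse on the good set, left inverse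
(uniqueness) in the `ρ`-ball, and the JOINT Lipschitz estimate in `(V, v)` for good environments at sup-distance `≤ d₀` (family radius `s + ρ + d₀ ≤ 1∕24`).
[cite: Balaban1987RG1, (0.4) p.253 and (2.4) p.266] -/
theorem oneBond_localInverse_family (p : ι → Prop) [DecidablePred p] (i₀ : ι) {s ρ d₀ : ℝ} (hs0 : 0 ≤ s) (hρ0 : 0 ≤ ρ) (hd0 : 0 ≤ d₀)
    (hr : s + ρ + d₀ ≤ 1 / 24) (hrδ : s + ρ + d₀ < deltaSU n)
    (hq : ((Finset.univ.filter fun i => ¬ p i).card : ℝ) / (Fintype.card ι : ℝ) + 144 * (s + ρ + d₀) < 1) :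
    ∃ θ : (ι → Matrix.specialUnitaryGroup n ℂ) → Matrix.specialUnitaryGroup n ℂ → Matrix.specialUnitaryGroup n ℂ,
      (∀ (V : ι → Matrix.specialUnitaryGroup n ℂ) (v : Matrix.specialUnitaryGroup n ℂ),
        (∀ i, ¬ p i → ‖(V i : Matrix n n ℂ) - (V i₀ : Matrix n n ℂ)‖ ≤ s) →
        ‖(v : Matrix n n ℂ) - (V i₀ : Matrix n n ℂ)‖ ≤
          ρ - (((Finset.univ.filter fun i => ¬ p i).card : ℝ) / (Fintype.card ι : ℝ) * (s + ρ) + 36 * (s + ρ) ^ 2) →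
        ‖(θ V v : Matrix n n ℂ) - (V i₀ : Matrix n n ℂ)‖ ≤ ρ ∧
          (expMeanLogSU (n := n)).avg (fun i => if p i then (1 : Matrix.specialUnitaryGroup n ℂ) else V i * (θ V v)⁻¹) * θ V v = v) ∧
      (∀ (V : ι → Matrix.specialUnitaryGroup n ℂ) (W : Matrix.specialUnitaryGroup n ℂ),
        (∀ i, ¬ p i → ‖(V i : Matrix n n ℂ) - (V i₀ : Matrix n n ℂ)‖ ≤ s) →
        ‖(W : Matrix n n ℂ) - (V i₀ : Matrix n n ℂ)‖ ≤ ρ →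
        ‖(((expMeanLogSU (n := n)).avg (fun i => if p i then (1 : Matrix.specialUnitaryGroup n ℂ) else V i * W⁻¹) * W :
            Matrix.specialUnitaryGroup n ℂ) : Matrix n n ℂ) - (V i₀ : Matrix n n ℂ)‖ ≤
          ρ - (((Finset.univ.filter fun i => ¬ p i).card : ℝ) / (Fintype.card ι : ℝ) * (s + ρ) + 36 * (s + ρ) ^ 2) →
        θ V ((expMeanLogSU (n := n)).avg (fun i => if p i then (1 : Matrix.specialUnitaryGroup n ℂ) else V i * W⁻¹) * W) = W) ∧
      (∀ (V V' : ι → Matrix.specialUnitaryGroup n ℂ) (v v' : Matrix.specialUnitaryGroup n ℂ) (d : ℝ), 0 ≤ d → d ≤ d₀ →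
        (∀ i, ¬ p i → ‖(V i : Matrix n n ℂ) - (V' i : Matrix n n ℂ)‖ ≤ d) →
        (∀ i, ¬ p i → ‖(V i : Matrix n n ℂ) - (V i₀ : Matrix n n ℂ)‖ ≤ s) →
        (∀ i, ¬ p i → ‖(V' i : Matrix n n ℂ) - (V' i₀ : Matrix n n ℂ)‖ ≤ s) →
        ‖(V i₀ : Matrix n n ℂ) - (V' i₀ : Matrix n n ℂ)‖ ≤ d →
        ‖(v : Matrix n n ℂ) - (V i₀ : Matrix n n ℂ)‖ ≤
          ρ - (((Finset.univ.filter fun i => ¬ p i).card : ℝ) / (Fintype.card ι : ℝ) * (s + ρ) + 36 * (s + ρ) ^ 2) →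
        ‖(v' : Matrix n n ℂ) - (V' i₀ : Matrix n n ℂ)‖ ≤
          ρ - (((Finset.univ.filter fun i => ¬ p i).card : ℝ) / (Fintype.card ι : ℝ) * (s + ρ) + 36 * (s + ρ) ^ 2) →
        (1 - (((Finset.univ.filter fun i => ¬ p i).card : ℝ) / (Fintype.card ι : ℝ) + 144 * (s + ρ + d₀))) *
            ‖(θ V v : Matrix n n ℂ) - (θ V' v' : Matrix n n ℂ)‖ ≤ ‖(v : Matrix n n ℂ) - (v' : Matrix n n ℂ)‖ + 12 * d) := by
  classical
  set μ : ℝ := ((Finset.univ.filter fun i => ¬ p i).card : ℝ) / (Fintype.card ι : ℝ) with hμ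
  have hμ0 : 0 ≤ μ := by positivity
  set ρ' : ℝ := ρ - (μ * (s + ρ) + 36 * (s + ρ) ^ 2) with hρ'
  -- the per-environment hypotheses of ★★ at radius `s + ρ`
  have hr1 : s + ρ ≤ 1 / 24 := by linarith
  have hrδ1 : s + ρ < deltaSU n := by linarith
  have hq1 : μ + 144 * (s + ρ) < 1 := by nlinarith
  have hex : ∀ (V : ι → Matrix.specialUnitaryGroup n ℂ) (v : Matrix.specialUnitaryGroup n ℂ),
      (∀ i, ¬ p i → ‖(V i : Matrix n n ℂ) - (V i₀ : Matrix n n ℂ)‖ ≤ s) → ‖(v : Matrix n n ℂ) - (V i₀ : Matrix n n ℂ)‖ ≤ ρ' →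
      ∃ W : Matrix.specialUnitaryGroup n ℂ, ‖(W : Matrix n n ℂ) - (V i₀ : Matrix n n ℂ)‖ ≤ ρ ∧
        (expMeanLogSU (n := n)).avg (fun i => if p i then (1 : Matrix.specialUnitaryGroup n ℂ) else V i * W⁻¹) * W = v :=
    fun V v hV hv => oneBond_exists_preimage p V (V i₀) hs0 hρ0 hV hr1 hrδ1 hq1 v hv
  -- family balls: a `ρ`-ball point is within `s + ρ` (own environment) ∕ `s + ρ + d` (a `d`-close environment) of every off-central `V_i`
  have hfam : ∀ (V : ι → Matrix.specialUnitaryGroup n ℂ) (W : Matrix.specialUnitaryGroup n ℂ),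
      (∀ i, ¬ p i → ‖(V i : Matrix n n ℂ) - (V i₀ : Matrix n n ℂ)‖ ≤ s) → ‖(W : Matrix n n ℂ) - (V i₀ : Matrix n n ℂ)‖ ≤ ρ →
      ∀ i, ¬ p i → ‖(V i : Matrix n n ℂ) - (W : Matrix n n ℂ)‖ ≤ s + ρ := by
    intro V W hV hW i hi
    calc ‖(V i : Matrix n n ℂ) - (W : Matrix n n ℂ)‖
        = ‖((V i : Matrix n n ℂ) - (V i₀ : Matrix n n ℂ)) + ((V i₀ : Matrix n n ℂ) - (W : Matrix n n ℂ))‖ := by rw [sub_add_sub_cancel]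
      _ ≤ s + ρ := (norm_add_le _ _).trans (add_le_add (hV i hi) (by rw [norm_sub_rev]; exact hW))
  have hfam' : ∀ (V V' : ι → Matrix.specialUnitaryGroup n ℂ) (W : Matrix.specialUnitaryGroup n ℂ) (d : ℝ),
      (∀ i, ¬ p i → ‖(V i : Matrix n n ℂ) - (V' i : Matrix n n ℂ)‖ ≤ d) →
      (∀ i, ¬ p i → ‖(V' i : Matrix n n ℂ) - (V' i₀ : Matrix n n ℂ)‖ ≤ s) → ‖(W : Matrix n n ℂ) - (V' i₀ : Matrix n n ℂ)‖ ≤ ρ →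
      ∀ i, ¬ p i → ‖(V i : Matrix n n ℂ) - (W : Matrix n n ℂ)‖ ≤ s + ρ + d := by
    intro V V' W d hVV' hV' hW i hi
    calc ‖(V i : Matrix n n ℂ) - (W : Matrix n n ℂ)‖
        = ‖((V i : Matrix n n ℂ) - (V' i : Matrix n n ℂ)) + ((V' i : Matrix n n ℂ) - (W : Matrix n n ℂ))‖ := by rw [sub_add_sub_cancel]
      _ ≤ d + (s + ρ) := (norm_add_le _ _).trans (add_le_add (hVV' i hi) (hfam V' W hV' hW i hi))
      _ = s + ρ + d := by ring
  -- the map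
  refine ⟨fun V v => if h : (∀ i, ¬ p i → ‖(V i : Matrix n n ℂ) - (V i₀ : Matrix n n ℂ)‖ ≤ s) ∧
      ‖(v : Matrix n n ℂ) - (V i₀ : Matrix n n ℂ)‖ ≤ ρ' then Classical.choose (hex V v h.1 h.2) else 1, ?_, ?_, ?_⟩
  · intro V v hV hv
    simp only [dif_pos (And.intro hV hv)]
    exact Classical.choose_spec (hex V v hV hv)
  · intro V W hV hW hFW
    simp only [dif_pos (And.intro hV hFW)]
    have hspec := Classical.choose_spec (hex V _ hV hFW)
    exact oneBond_injOn p V (by positivity) hr1 hrδ1 hq1 (hfam V _ hV hspec.1) (hfam V W hV hW) hspec.2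
  · intro V V' v v' d hd hdd hVV' hV hV' hi₀ hv hv'
    simp only [dif_pos (And.intro hV hv), dif_pos (And.intro hV' hv')]
    have h1 := Classical.choose_spec (hex V v hV hv)
    have h2 := Classical.choose_spec (hex V' v' hV' hv')
    set W := Classical.choose (hex V v hV hv) with hWdef
    set W' := Classical.choose (hex V' v' hV' hv') with hW'def
    -- both solutions lie in the `V`-family ball of radius `s + ρ + d₀`, and `W′` also in the `V′`-family ball
    have hrd : s + ρ ≤ s + ρ + d₀ := by linarith
    have hW1 : ∀ i, ¬ p i → ‖(V i : Matrix n n ℂ) - (W : Matrix n n ℂ)‖ ≤ s + ρ + d₀ :=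
      fun i hi => (hfam V W hV h1.1 i hi).trans hrd
    have hW2 : ∀ i, ¬ p i → ‖(V i : Matrix n n ℂ) - (W' : Matrix n n ℂ)‖ ≤ s + ρ + d₀ :=
      fun i hi => (hfam' V V' W' d hVV' hV' h2.1 i hi).trans (by linarith)
    have hW3 : ∀ i, ¬ p i → ‖(V' i : Matrix n n ℂ) - (W' : Matrix n n ℂ)‖ ≤ s + ρ + d₀ :=
      fun i hi => (hfam V' W' hV' h2.1 i hi).trans hrd
    exact oneBond_preimage_lipschitz p V V' (r := s + ρ + d₀) (d := d) (by positivity) hr hrδ hd (by linarith) hVV' hW1 hW2 hW3 h1.2 h2.2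

omit [Nonempty n] [Nonempty ι] in
/-- §2 ★★★ **JOINT CONTINUITY OF THE ONE-BOND LOCAL INVERSE ON THE GOOD SET** (sup distance on environments × operator-norm distance on targets): a consequence of
the joint Lipschitz estimate of `oneBond_localInverse_family`. [cite: Balaban1987RG1, (0.4) p.253 and (2.4) p.266] -/
theorem continuousOn_of_jointLipschitz (p : ι → Prop) [DecidablePred p] (i₀ : ι) {s ρ' d₀ L C : ℝ} (hd0 : 0 < d₀) (hL : 0 < L)
    (θ : (ι → Matrix.specialUnitaryGroup n ℂ) → Matrix.specialUnitaryGroup n ℂ → Matrix.specialUnitaryGroup n ℂ)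
    (hθ : ∀ (V V' : ι → Matrix.specialUnitaryGroup n ℂ) (v v' : Matrix.specialUnitaryGroup n ℂ) (d : ℝ), 0 ≤ d → d ≤ d₀ →
        (∀ i, ¬ p i → ‖(V i : Matrix n n ℂ) - (V' i : Matrix n n ℂ)‖ ≤ d) →
        (∀ i, ¬ p i → ‖(V i : Matrix n n ℂ) - (V i₀ : Matrix n n ℂ)‖ ≤ s) →
        (∀ i, ¬ p i → ‖(V' i : Matrix n n ℂ) - (V' i₀ : Matrix n n ℂ)‖ ≤ s) →
        ‖(V i₀ : Matrix n n ℂ) - (V' i₀ : Matrix n n ℂ)‖ ≤ d →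
        ‖(v : Matrix n n ℂ) - (V i₀ : Matrix n n ℂ)‖ ≤ ρ' → ‖(v' : Matrix n n ℂ) - (V' i₀ : Matrix n n ℂ)‖ ≤ ρ' →
        L * ‖(θ V v : Matrix n n ℂ) - (θ V' v' : Matrix n n ℂ)‖ ≤ ‖(v : Matrix n n ℂ) - (v' : Matrix n n ℂ)‖ + C * d) :
    ContinuousOn (fun q : (ι → Matrix.specialUnitaryGroup n ℂ) × Matrix.specialUnitaryGroup n ℂ => θ q.1 q.2)
      {q | (∀ i, ¬ p i → ‖(q.1 i : Matrix n n ℂ) - (q.1 i₀ : Matrix n n ℂ)‖ ≤ s) ∧ ‖(q.2 : Matrix n n ℂ) - (q.1 i₀ : Matrix n n ℂ)‖ ≤ ρ'} := by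
  rw [Metric.continuousOn_iff]
  intro q hq ε hε
  have hC : 0 ≤ max C 0 := le_max_right _ _
  -- choose δ ≤ d₀ with (δ + max C 0 · δ) / L < ε
  obtain ⟨δ, hδ0, hδd, hδε⟩ : ∃ δ : ℝ, 0 < δ ∧ δ ≤ d₀ ∧ (1 + max C 0) * δ < L * ε := by
    refine ⟨min d₀ (L * ε / (2 * (1 + max C 0))), lt_min hd0 (by positivity), min_le_left _ _, ?_⟩
    have h1 : (1 + max C 0) * min d₀ (L * ε / (2 * (1 + max C 0))) ≤ (1 + max C 0) * (L * ε / (2 * (1 + max C 0))) :=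
      mul_le_mul_of_nonneg_left (min_le_right _ _) (by positivity)
    have h2 : (1 + max C 0) * (L * ε / (2 * (1 + max C 0))) = L * ε / 2 := by field_simp
    have h3 : L * ε / 2 < L * ε := by nlinarith [mul_pos hL hε]
    linarith
  refine ⟨δ, hδ0, fun q' hq' hqq' => ?_⟩
  obtain ⟨V, v⟩ := q
  obtain ⟨V', v'⟩ := q'
  simp only [Set.mem_setOf_eq] at hq hq'
  rw [Prod.dist_eq, max_lt_iff] at hqq'
  have hVV' : ∀ i, ‖(V' i : Matrix n n ℂ) - (V i : Matrix n n ℂ)‖ ≤ δ := fun i => by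
    rw [← dist_eq_norm, ← Subtype.dist_eq]; exact ((dist_le_pi_dist V' V i).trans hqq'.1.le)
  have hvv' : ‖(v' : Matrix n n ℂ) - (v : Matrix n n ℂ)‖ < δ := by rw [← dist_eq_norm, ← Subtype.dist_eq]; exact hqq'.2
  have key := hθ V' V v' v δ hδ0.le hδd (fun i _ => hVV' i) hq'.1 hq.1 (hVV' i₀) hq'.2 hq.2
  rw [Subtype.dist_eq, dist_eq_norm]
  show ‖((θ V' v' : Matrix.specialUnitaryGroup n ℂ) : Matrix n n ℂ) - ((θ V v : Matrix.specialUnitaryGroup n ℂ) : Matrix n n ℂ)‖ < ε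
  have hCd : C * δ ≤ max C 0 * δ := mul_le_mul_of_nonneg_right (le_max_left _ _) hδ0.le
  by_contra hge
  push Not at hge
  nlinarith [mul_le_mul_of_nonneg_left hge hL.le, norm_nonneg ((v' : Matrix n n ℂ) - (v : Matrix n n ℂ))]

/-- §2 ★★★ **COROLLARY: THE ONE-BOND LOCAL INVERSE OF `oneBond_localInverse_family` IS JOINTLY CONTINUOUS ON THE GOOD SET** (for `q₊ < 1`, `0 < d₀`).
[cite: Balaban1987RG1, (0.4) p.253 and (2.4) p.266] -/
theorem continuousOn_oneBond_localInverse_family (p : ι → Prop) [DecidablePred p] (i₀ : ι) {s ρ d₀ : ℝ} (hs0 : 0 ≤ s) (hρ0 : 0 ≤ ρ) (hd0 : 0 < d₀)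
    (hr : s + ρ + d₀ ≤ 1 / 24) (hrδ : s + ρ + d₀ < deltaSU n)
    (hq : ((Finset.univ.filter fun i => ¬ p i).card : ℝ) / (Fintype.card ι : ℝ) + 144 * (s + ρ + d₀) < 1) :
    ∃ θ : (ι → Matrix.specialUnitaryGroup n ℂ) → Matrix.specialUnitaryGroup n ℂ → Matrix.specialUnitaryGroup n ℂ,
      (∀ (V : ι → Matrix.specialUnitaryGroup n ℂ) (v : Matrix.specialUnitaryGroup n ℂ),
        (∀ i, ¬ p i → ‖(V i : Matrix n n ℂ) - (V i₀ : Matrix n n ℂ)‖ ≤ s) →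
        ‖(v : Matrix n n ℂ) - (V i₀ : Matrix n n ℂ)‖ ≤
          ρ - (((Finset.univ.filter fun i => ¬ p i).card : ℝ) / (Fintype.card ι : ℝ) * (s + ρ) + 36 * (s + ρ) ^ 2) →
        ‖(θ V v : Matrix n n ℂ) - (V i₀ : Matrix n n ℂ)‖ ≤ ρ ∧
          (expMeanLogSU (n := n)).avg (fun i => if p i then (1 : Matrix.specialUnitaryGroup n ℂ) else V i * (θ V v)⁻¹) * θ V v = v) ∧
      (∀ (V : ι → Matrix.specialUnitaryGroup n ℂ) (W : Matrix.specialUnitaryGroup n ℂ),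
        (∀ i, ¬ p i → ‖(V i : Matrix n n ℂ) - (V i₀ : Matrix n n ℂ)‖ ≤ s) →
        ‖(W : Matrix n n ℂ) - (V i₀ : Matrix n n ℂ)‖ ≤ ρ →
        ‖(((expMeanLogSU (n := n)).avg (fun i => if p i then (1 : Matrix.specialUnitaryGroup n ℂ) else V i * W⁻¹) * W :
            Matrix.specialUnitaryGroup n ℂ) : Matrix n n ℂ) - (V i₀ : Matrix n n ℂ)‖ ≤
          ρ - (((Finset.univ.filter fun i => ¬ p i).card : ℝ) / (Fintype.card ι : ℝ) * (s + ρ) + 36 * (s + ρ) ^ 2) →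
        θ V ((expMeanLogSU (n := n)).avg (fun i => if p i then (1 : Matrix.specialUnitaryGroup n ℂ) else V i * W⁻¹) * W) = W) ∧
      ContinuousOn (fun q : (ι → Matrix.specialUnitaryGroup n ℂ) × Matrix.specialUnitaryGroup n ℂ => θ q.1 q.2)
        {q | (∀ i, ¬ p i → ‖(q.1 i : Matrix n n ℂ) - (q.1 i₀ : Matrix n n ℂ)‖ ≤ s) ∧
          ‖(q.2 : Matrix n n ℂ) - (q.1 i₀ : Matrix n n ℂ)‖ ≤
            ρ - (((Finset.univ.filter fun i => ¬ p i).card : ℝ) / (Fintype.card ι : ℝ) * (s + ρ) + 36 * (s + ρ) ^ 2)} := by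
  obtain ⟨θ, h1, h2, h3⟩ := oneBond_localInverse_family p i₀ hs0 hρ0 hd0.le hr hrδ hq
  refine ⟨θ, h1, h2, continuousOn_of_jointLipschitz p i₀ hd0 (by linarith) θ h3⟩

end Summit.QuantumFields.YangMills.Theorems.FluctuationComparisonRegPrIntLOneBondLocalInverse

end
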